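import Literature.MathematicalPhysics.QuantumFieldTheory.Balaban1983to89.B9Eq3129H1TransposeCoords
import Literature.MathematicalPhysics.QuantumFieldTheory.Balaban1983to89.B9SupLettersFromClassLetters

/-!
# `Balaban1983to89.B9Eq3129H1TransposeCancel` — [B9] (3.129) `H₁ = G₁Q*(QG₁Q*)⁻¹`, (3.42) for `G₁` (Thm 3.12) and (3.132) for `(QG₁Q*)⁻¹`: THE [4]-(2.51) MAJORANT
# OF THE COUNTING-TRANSPOSE `(C₁ ∘ Q) ∘ G₁` WITH THE SCALE FACTORS KEPT — `G₁`'s output `(Lʲη)²` CANCELS `C₁`'s input `(L^{j′}η)⁻²` ACROSS THE LOCAL `Q` STEP (p. 398's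
# one transfer), so that the transpose carries EXACTLY the block count `n_c` at the coarse end and the (b†) weight law of the (3.24) doors holds at every coarse bond

T. Bałaban, *Propagators for lattice gauge theories in a background field*, Commun. Math. Phys. **99** (1985) 389–434 [Balaban1985BackgroundPropagators] (= [B9]):
(3.42) p. 397 (the `(Lʲη)²` of `G`), p. 398 (remark after (3.47): *«we can transfer these powers from one side to another»*), (3.128)–(3.129) p. 421, (3.132)–(3.133)
p. 422 (*«|(QG₁Q\*)⁻¹(y, y′)| ≦ O(1)(Lʲη)⁻²(L^{j′}η)^{−d}e^{−δ₁d(y,y′)}»*), (3.136) p. 422, Thm 3.12 p. 423, (3.12)–(3.14) pp. 392–393; [Balaban1984PropagatorsII] (= [4])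
(2.51)–(2.56) pp. 232–233, Lemma 2.1 (2.60)–(2.61) p. 234.  statement-level companion of published sources with citation tags; every declaration here is a theorem;
nothing here is a claim about the Yang–Mills mass gap.

WHY THIS MODULE (cell `pub-ymgap`, seat `dag-n08-d` gen 44, LOCATED + CORRECTION + INTENT-111, 2026-08-29).  `B9Eq3129H1TransposeCoords` §2 (p712155) composes the
(3.24) doors' transpose family `𝔗 = (C₁ ∘ Q) ∘ G₁` from a FLAT `G₁` sup letter `hG1sup` (`r_G·e^{−(1−α)δ₀d}`) and an OUTPUT-weighted `C₁` letter `hC1sup`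
(`r_C·W_C(a)·e^{−δ₀d}`), so that `W_T = W_C`.  Along the typed road for `hC1sup` (the `𝔠⁽²⁾ → Z_{n⁻¹}` class letter of (3.132) read through n06-w8's F11 §2) the
weight is `W_C = L₀²·n·(Lʲη)⁻²`, and the doors' law `η^{d+1}·(W(c)·((Lʲη)_c³)⁻¹) ≤ w₁` then reads `L₀²·(Lʲη)_c^{(d+1)−5} ≤ w₁` — VACUOUS at d+1 = 4
(`B9Eq3136HstarJAtPinsLetterFamily` §6).  The two powers are lost by FLATTENING `G₁` ((3.42) gives `|G₁μ| ≦ O(1)(Lʲη)_a²·e^{−δd}·sup|μ|` on the block of `a` —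
n06-l's `e0` shape, `HasMajorant blk (G U) (B·(Lʲη)_a²·e^{−δd})`) and by TRANSFERRING `C₁`'s input factor to its output.  THIS FILE keeps both factors where print
has them: with `G₁` in the `e0` shape and `C₁` read RAW (n06-w5 `B9LettersZCFieldsAtPins.hasMajorantHom_raw_of_hasMaj_cNorm_weightNorm`'s two-variable kernel
`r_C·P(a)·((L^{j′}η)_b²)⁻¹·e^{−δd}`), the factors `(Lʲη)_{a′}^{+2}` (output block of `G₁`) and `(Lʲη)_b^{−2}` (input block of `C₁`) sit at the two ends of the
LOCAL `Q` step and cancel after ONE p. 398 transfer (F11 `len_sq_ratio_transfer`, constant `L₀²`, rate `α₁δ₁`): the composite carries `P(a)` ONLY — at the record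
`P = n` (the block count), for which the doors' law holds at EVERY coarse bond once `3 ≤ d+1` (`B9Eq3136HstarJAtPinsLetterFamily` §1).
* §1 ★★ `hasMajorantHom_CQG_of_e0_raw_letters` — F9 §2 `B9Eq3126HTransposeCoords.hasMajorantHom_CQG_of_letters`'s twin: from `hG : HasMajorant blk G (r_G·(Lʲη)_a²·e^{−(1−α)δd})`
  and `hC : HasMajorantHom blkHK blkHK C (r_C·P(a)·((Lʲη)_b²)⁻¹·e^{−δd})`, the composite `(C ∘ Q) ∘ G` has the [4]-(2.51) majorant
  `r_C·c₁·P(a)·(e^{(δ+α₁δ₁)(ℓ+4)}·L₀²·c₁·r_G)·e^{−(1−α)δ d}` (F9's shape with `1 ↦ L₀²`, `δ(ℓ+4) ↦ (δ+α₁δ₁)(ℓ+4)`);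
* §1b ★ `blockCount_eq_pow_lvl` — the doors' block count `((Lʲη)_c∕η)^{d+1}` IS node N06's `(L^{d+1})^{j(c)}` (the `Z_{n⁻¹}` weight inverted);
* §2 ★★ `hH1T_of_G1e0_C1raw_lettersR` — p712155 §2's twin at the pins (member facts: (2.61) at `(δ₀, α)` and [4] (2.60) at `((1−2α)δ₀, α_F)`, `L₀ = ℓ+1`, from
  `lemma21Pack_geo9Y`): the doors' schema `hH1T` with `W_T = P` from `hG1e0 + hC1raw + hΔ2`;
* §3 ★★★ `etaDY_mul_norm_trAdjY_H1Y_JY_le_of_G1e0_C1raw_lettersR_blockCount` — p712155 §3's twin at `P := n` (block count): the doors' 𝒥-row input (b†)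
  `η^{d+1}·‖(H₁(U)†J(U))(c)‖ ≤ t_{HJ}·a` at EVERY coarse bond `c`, NO WEIGHT LAW (`3 ≤ d+1`; `B9Eq3136HstarJAtPinsLetterFamily.…_blockCount`).
WHAT IT ASKS OF NODE N06 (displayed, printed shape): `hG1e0 : HasMajorant (blkBK (bI x)) (GcoK … (G1Y … (GpPhysY …) (𝔯 x).Δ2) U) (r_G·(geo9Y x).len a ^ 2·e^{−(1−α)δ₀ d})`
((3.42) for `G₁`, Thm 3.12) and `hC1raw : HasMajorantHom blkHK blkHK (C1coK … U) (r_C·n_a·((geo9Y x).len b ^ 2)⁻¹·e^{−δ₀ d})` ((3.132) for `(QG₁Q\*)⁻¹`, the RAW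
reading of the `𝔠⁽²⁾ → Z_{n⁻¹}` class letter), `hΔ2`.
HONEST SCOPE.  [4] (2.51)∕(2.54)∕(2.55)∕(2.60)∕(2.61) bookkeeping with explicit constants BY NAME (n06-w5's `Q` letter, n06-w8's F9∕F11, p21∕n06-k member facts,
def-Y's dictionary); the majorants of `G₁` and `C₁` are HYPOTHESES of printed shape; nothing of [B9] asserted; count-neutral; N06 ∕ N08 NOT discharged; one finite
lattice at a time — nothing continuum ∕ ℝ⁴ ∕ OS ∕ mass gap ∕ Clay.  No `sorry`, no `def`, no `instance`, no `notation`.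
-/

noncomputable section

namespace Literature.MathematicalPhysics.QuantumFieldTheory.Balaban1983to89.B9Eq3129H1TransposeCancel

open Node00 (CfgY FBondY IBondY SiteParY BondParY SiteOpY BondOpY parBY parSymY GpY GpPhysY H1Y G1Y Stage3Params ResY etaDY etaBY etaS trDualMatY trAdjY JY)
open Node00.OpsYSectDCoords (QcoKH C1coK)
open B6KLevelCensusIndexV1 (KIdx)
open B9Thm37Glue (IsTransposePair)
open B6RandomWalk (HasMajorant Triangle254 Ineq261)
open B6RandomWalkHom (HasMajorantHom hasMajorantHom_comp hasMajorantHom_mono hasMajorantHom_iff)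
open B6RandomWalkL2Chain (kernel_G0_conv_le)
open B9Thm34Ext (toB6)
open B9Thm312Whole (GeoOK)
open B9RWSums343to347Whole (Facts347)
open B9SupLettersFromClassLetters (len_sq_ratio_transfer)
open B9CoReadingCoords (XBK blkBK GcoK)
open B9CoReadingCoordsH (XHK blkHK HcoK)
open B9CoReadingCoordsTranspose (TrIdx trBasis)
open B9Thm311ReadingCoords (IsSymmTr)
open B9Thm39ReadingCoords (basisBound39)
open B9GeoNormsKLevelV1 (geo9K geo9K_dist_nonneg)
open B9QLettersAtPins (hasMajorantHom_QcoKH)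
open B6Ineq2142KLevelV1 (β lvl beta_level)
open B9Ineq349SiteComposite (lenB_eq)
open B9Ineq349SiteFromBlocks (geo9Y_len_eq_lenB etaS_eq_abs_cf_inv)
open B6GlobalChartV1 (PV blkV1)
open B6Geom246MultiLevelTorus (geomT)
open B9Eq3129H1TransposeCoords (isTransposePair_HcoK_H1Y_physY)
open B9RWSumsDefinitePins (PinPrims)
open B9RWSums347DefiniteFaces (exp261 lemma21Pack_geo9Y)
open B9RowSum261DefiniteFaces (rowConst261)
open B9PinMembersKLevelV1 (MemberY geo9Y bg9Y)
open B9GeoLemma21KLevelV1 (geo9Y_dist_triangle geo9Y_dist_comm geo9Y_len_pos)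
open B7Prop2SpecialUnitary (specialUnitaryUnits specialUnitaryUnits_le_unitaryUnits specialUnitaryUnits_le_U1)
open B9BackgroundsKLevelV1 (shiftsV1)
open B9BackgroundsKLevelV1R (RegFamY bg9YR MemOfFam)
open B9Eq336CurrentBound (RegularAt)
open B9Eq3136HstarJAtPinsLetterFamily (etaBY_pos' etaDY_mul_norm_trAdjY_H1Y_JY_le_of_transpose_schemas_blockCount)
open scoped Matrix
open scoped Matrix.Norms.L2Operator

variable {N : ℕ} {d ℓ : ℕ} {hd : 1 ≤ d + 1} {hL : Odd (ℓ + 1) ∧ 1 < ℓ + 1} {b₀ b₁ : ℝ}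
variable (i : KIdx d ℓ hd hL b₀ b₁) (B : B9.Backgrounds) (cfg : B.Cfg → CfgY (Matrix (Fin N) (Fin N) ℂ) i)

/-! ## §1 The [4]-(2.51) majorant of `(C ∘ Q) ∘ G` with `G` in the `e0` shape and `C` raw: the scale factors cancel across `Q` -/

section Majorant

variable {R₀ : ℝ} {H₀ : Prop}

/-- ★★ **THE MAJORANT OF THE TRANSPOSE COMPOSITE WITH THE SCALE FACTORS KEPT — THEY CANCEL ACROSS `Q`**: over the record geometry `geo9K i` (blocks `blkBK bI` on the
fine bonds, `blkHK` on the coarse bonds; `bI` 1-faithful; member facts `Facts347 … δ₁ α₁ L₀` and (2.61) at `(δ, α)`), at a configuration with contracting taxicab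
transporters: if the model of `G(U)` has the sup majorant `r_G·(Lʲη)_a²·e^{−(1−α)δ d}` ((3.42)'s shape, the `(Lʲη)²` of the OUTPUT block KEPT — n06-l's `e0`) and the
model of `C(U)` the two-variable majorant `r_C·P(a)·((L^{j′}η)_b²)⁻¹·e^{−δ d}` ((3.132)'s shape read RAW — n06-w5's `hasMajorantHom_raw_of_hasMaj_cNorm_weightNorm`, any
`P ≧ 0` at the output; at the record `P = n`), then `(C ∘ Q) ∘ G` has the [4]-(2.51) majorant `r_C·c₁·P(a)·(e^{(δ+α₁δ₁)(ℓ+4)}·L₀²·c₁·r_G)·e^{−(1−α)δ d(a, y′)}` from the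
fine carrier to the coarse one: `Q`'s majorant taken at rate `δ + α₁δ₁` (n06-w5), its surplus `e^{−α₁δ₁d}` moves `G`'s `(Lʲη)_{a′}²` to `Q`'s output block `b`
(`len_sq_ratio_transfer`, `≦ L₀²·(Lʲη)_b²`), where it cancels `C`'s `((Lʲη)_b²)⁻¹`; two convolutions, one `c₁` each.
[cite: Balaban1985BackgroundPropagators, (3.42) p.397, p.398 (remark after (3.47)), (3.129) p.421, (3.132)–(3.133) p.422, (3.12)–(3.14) pp.392–393; Balaban1984PropagatorsII, (2.51)–(2.56) pp.232–233, Lemma 2.1 (2.60)–(2.61) p.234, (2.66) p.234] -/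
theorem hasMajorantHom_CQG_of_e0_raw_letters [Fintype (geo9K i).Site] {bI : FBondY i → IBondY i}
    (hβ1 : ∀ f : FBondY i, (geomT i.D).dist (β i.hN i.D i.hk (bI f)) (blkV1 i.hN i.D f) ≤ 1) (U₁ : B.Cfg)
    (hpar : ∀ s s', ‖(parBY i (cfg U₁) s s' : Matrix (Fin N) (Fin N) ℂ)‖ ≤ 1 ∧ ‖(((parBY i (cfg U₁) s s')⁻¹ : (Matrix (Fin N) (Fin N) ℂ)ˣ) : Matrix (Fin N) (Fin N) ℂ)‖ ≤ 1)
    (hGeo : GeoOK (geo9K i)) {dF : ℕ} {δ₁ α₁ L₀ : ℝ} (hF : Facts347 (geo9K i) R₀ H₀ dF δ₁ α₁ L₀)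
    {dd : ℕ} {δ α rG rC : ℝ} {P : (geo9K i).Site → ℝ}
    (hδ : 0 ≤ δ) (hαδ : 0 ≤ (1 - α) * δ) (hαδ₁ : 0 ≤ α₁ * δ₁) (hrG : 0 ≤ rG) (hrC : 0 ≤ rC) (hP : ∀ a, 0 ≤ P a)
    (h261 : Ineq261 dd (toB6 (geo9K i) R₀ H₀) δ α)
    {CC : (XHK (TrIdx N) i → ℝ) →ₗ[ℝ] (XHK (TrIdx N) i → ℝ)} {GG : (XBK (TrIdx N) i → ℝ) →ₗ[ℝ] (XBK (TrIdx N) i → ℝ)}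
    (hG : HasMajorant (g := toB6 (geo9K i) R₀ H₀) (blkBK i bI) GG (fun a b => rG * (geo9K i).len a ^ 2 * Real.exp (-((1 - α) * δ * (geo9K i).dist a b))))
    (hC : HasMajorantHom (g := toB6 (geo9K i) R₀ H₀) (blkHK i) (blkHK i) CC
      (fun a b => rC * P a * ((geo9K i).len b ^ 2)⁻¹ * Real.exp (-(δ * (geo9K i).dist a b)))) :
    HasMajorantHom (g := toB6 (geo9K i) R₀ H₀) (blkBK i bI) (blkHK i) ((CC ∘ₗ QcoKH i (trBasis N) B cfg (parBY i) U₁) ∘ₗ GG)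
      (fun a b => rC * B6.c1 dd δ α * P a * (Real.exp ((δ + α₁ * δ₁) * ((ℓ : ℝ) + 4)) * L₀ ^ 2 * B6.c1 dd δ α * rG) *
        Real.exp (-((1 - α) * δ * (geo9K i).dist a b))) := by
  have htri : Triangle254 (toB6 (geo9K i) R₀ H₀) := fun a b c => hGeo.tri a b c
  have hδQ : 0 ≤ δ + α₁ * δ₁ := add_nonneg hδ hαδ₁
  -- Q : fine → coarse at rate δ + α₁δ₁ (n06-w5)
  have hQ := hasMajorantHom_QcoKH i (trBasis N) B cfg (parBY i) hβ1 (U₁ := U₁) hpar hδQ R₀ H₀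
  -- (1) `Q ∘ G`: insert the fine partition; move `(Lʲη)_{a′}²` to `Q`'s output block with the surplus rate `α₁δ₁`; convolve (one `c₁`)
  have hKG : ∀ a b : (geo9K i).Site, 0 ≤ rG * (geo9K i).len a ^ 2 * Real.exp (-((1 - α) * δ * (geo9K i).dist a b)) :=
    fun a b => mul_nonneg (mul_nonneg hrG (sq_nonneg _)) (Real.exp_nonneg _)
  have hQG₀ := hasMajorantHom_comp (g := toB6 (geo9K i) R₀ H₀) (blkBK i bI) (blkBK i bI) (blkHK i)
    (T₁ := QcoKH i (trBasis N) B cfg (parBY i) U₁) (T₂ := GG) hQ ((hasMajorantHom_iff _ _ _).2 hG) hKG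
  have hA₀ : 0 ≤ Real.exp ((δ + α₁ * δ₁) * ((ℓ : ℝ) + 4)) * L₀ ^ 2 := mul_nonneg (Real.exp_nonneg _) (sq_nonneg _)
  have hQG : HasMajorantHom (g := toB6 (geo9K i) R₀ H₀) (blkBK i bI) (blkHK i) (QcoKH i (trBasis N) B cfg (parBY i) U₁ ∘ₗ GG)
      (fun b y' => Real.exp ((δ + α₁ * δ₁) * ((ℓ : ℝ) + 4)) * L₀ ^ 2 * B6.c1 dd δ α * (geo9K i).len b ^ 2 * rG *
        Real.exp (-((1 - α) * δ * (geo9K i).dist b y'))) := by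
    refine hasMajorantHom_mono _ _ hQG₀ fun b y' => ?_
    have hterm : ∀ a' : (geo9K i).Site,
        Real.exp ((δ + α₁ * δ₁) * ((ℓ : ℝ) + 4)) * Real.exp (-((δ + α₁ * δ₁) * (geo9K i).dist b a')) *
            (rG * (geo9K i).len a' ^ 2 * Real.exp (-((1 - α) * δ * (geo9K i).dist a' y'))) ≤
          Real.exp ((δ + α₁ * δ₁) * ((ℓ : ℝ) + 4)) * L₀ ^ 2 * (geo9K i).len b ^ 2 * Real.exp (-(δ * (geo9K i).dist b a')) *
            (rG * Real.exp (-((1 - α) * δ * (geo9K i).dist a' y'))) := by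
      intro a'
      -- the transfer: e^{−α₁δ₁ d(a′,b)}·(Lʲη)_{a′}² ≤ L₀²·(Lʲη)_b²
      have ht := len_sq_ratio_transfer (R₀ := R₀) (H₀ := H₀) hGeo hF a' b
      have hb2 : 0 < (geo9K i).len b ^ 2 := pow_pos (hGeo.lenpos b) 2
      have ht' : Real.exp (-(α₁ * δ₁ * (geo9K i).dist b a')) * (geo9K i).len a' ^ 2 ≤ L₀ ^ 2 * (geo9K i).len b ^ 2 := by
        have h1 : ((geo9K i).len b ^ 2)⁻¹ * (geo9K i).len b ^ 2 = 1 := inv_mul_cancel₀ hb2.ne'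
        calc Real.exp (-(α₁ * δ₁ * (geo9K i).dist b a')) * (geo9K i).len a' ^ 2
            = Real.exp (-(α₁ * δ₁ * (geo9K i).dist a' b)) * (geo9K i).len a' ^ 2 * (((geo9K i).len b ^ 2)⁻¹ * (geo9K i).len b ^ 2) := by
              rw [hGeo.symm b a', h1, mul_one]
          _ = Real.exp (-(α₁ * δ₁ * (geo9K i).dist a' b)) * ((geo9K i).len a' ^ 2 * ((geo9K i).len b ^ 2)⁻¹) * (geo9K i).len b ^ 2 := by ring
          _ ≤ L₀ ^ 2 * (geo9K i).len b ^ 2 := mul_le_mul_of_nonneg_right ht hb2.le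
      have hsplit : Real.exp (-((δ + α₁ * δ₁) * (geo9K i).dist b a')) =
          Real.exp (-(δ * (geo9K i).dist b a')) * Real.exp (-(α₁ * δ₁ * (geo9K i).dist b a')) := by
        rw [← Real.exp_add]; ring_nf
      have hE0 : 0 ≤ Real.exp ((δ + α₁ * δ₁) * ((ℓ : ℝ) + 4)) * Real.exp (-(δ * (geo9K i).dist b a')) *
          (rG * Real.exp (-((1 - α) * δ * (geo9K i).dist a' y'))) :=
        mul_nonneg (mul_nonneg (Real.exp_nonneg _) (Real.exp_nonneg _)) (mul_nonneg hrG (Real.exp_nonneg _))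
      calc Real.exp ((δ + α₁ * δ₁) * ((ℓ : ℝ) + 4)) * Real.exp (-((δ + α₁ * δ₁) * (geo9K i).dist b a')) *
            (rG * (geo9K i).len a' ^ 2 * Real.exp (-((1 - α) * δ * (geo9K i).dist a' y')))
          = (Real.exp ((δ + α₁ * δ₁) * ((ℓ : ℝ) + 4)) * Real.exp (-(δ * (geo9K i).dist b a')) *
              (rG * Real.exp (-((1 - α) * δ * (geo9K i).dist a' y')))) *
              (Real.exp (-(α₁ * δ₁ * (geo9K i).dist b a')) * (geo9K i).len a' ^ 2) := by rw [hsplit]; ring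
        _ ≤ (Real.exp ((δ + α₁ * δ₁) * ((ℓ : ℝ) + 4)) * Real.exp (-(δ * (geo9K i).dist b a')) *
              (rG * Real.exp (-((1 - α) * δ * (geo9K i).dist a' y')))) * (L₀ ^ 2 * (geo9K i).len b ^ 2) :=
            mul_le_mul_of_nonneg_left ht' hE0
        _ = _ := by ring
    have hconv := kernel_G0_conv_le (g := toB6 (geo9K i) R₀ H₀) dd δ α (Real.exp ((δ + α₁ * δ₁) * ((ℓ : ℝ) + 4)) * L₀ ^ 2) rG
      (fun b => (geo9K i).len b ^ 2) hA₀ (fun b => sq_nonneg _) hrG hαδ htri h261 b y'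
    calc ∑ a' : (geo9K i).Site, Real.exp ((δ + α₁ * δ₁) * ((ℓ : ℝ) + 4)) * Real.exp (-((δ + α₁ * δ₁) * (geo9K i).dist b a')) *
            (rG * (geo9K i).len a' ^ 2 * Real.exp (-((1 - α) * δ * (geo9K i).dist a' y')))
        ≤ ∑ a' : (geo9K i).Site, Real.exp ((δ + α₁ * δ₁) * ((ℓ : ℝ) + 4)) * L₀ ^ 2 * (geo9K i).len b ^ 2 * Real.exp (-(δ * (geo9K i).dist b a')) *
            (rG * Real.exp (-((1 - α) * δ * (geo9K i).dist a' y'))) := Finset.sum_le_sum fun a' _ => hterm a'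
      _ ≤ Real.exp ((δ + α₁ * δ₁) * ((ℓ : ℝ) + 4)) * L₀ ^ 2 * B6.c1 dd δ α * (geo9K i).len b ^ 2 * rG *
            Real.exp (-((1 - α) * δ * (geo9K i).dist b y')) := hconv
  -- (2) `C ∘ (Q ∘ G)`: insert the coarse partition; `((Lʲη)_b²)⁻¹·(Lʲη)_b² = 1`; convolve (one more `c₁`)
  have hc1 : 0 ≤ B6.c1 dd δ α := B6RandomWalk.c1_nonneg dd δ α
  have hK₂ : ∀ b y' : (geo9K i).Site, 0 ≤ Real.exp ((δ + α₁ * δ₁) * ((ℓ : ℝ) + 4)) * L₀ ^ 2 * B6.c1 dd δ α * (geo9K i).len b ^ 2 * rG *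
      Real.exp (-((1 - α) * δ * (geo9K i).dist b y')) := fun b y' =>
    mul_nonneg (mul_nonneg (mul_nonneg (mul_nonneg hA₀ hc1) (sq_nonneg _)) hrG) (Real.exp_nonneg _)
  have hcomp := hasMajorantHom_comp (g := toB6 (geo9K i) R₀ H₀) (blkBK i bI) (blkHK i) (blkHK i) (T₁ := CC)
    (T₂ := QcoKH i (trBasis N) B cfg (parBY i) U₁ ∘ₗ GG) hC hQG hK₂
  rw [← LinearMap.comp_assoc] at hcomp
  refine hasMajorantHom_mono _ _ hcomp fun a y' => ?_
  have hcancel : ∀ b : (geo9K i).Site,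
      rC * P a * ((geo9K i).len b ^ 2)⁻¹ * Real.exp (-(δ * (geo9K i).dist a b)) *
          (Real.exp ((δ + α₁ * δ₁) * ((ℓ : ℝ) + 4)) * L₀ ^ 2 * B6.c1 dd δ α * (geo9K i).len b ^ 2 * rG *
            Real.exp (-((1 - α) * δ * (geo9K i).dist b y'))) =
        rC * P a * Real.exp (-(δ * (geo9K i).dist a b)) *
          ((Real.exp ((δ + α₁ * δ₁) * ((ℓ : ℝ) + 4)) * L₀ ^ 2 * B6.c1 dd δ α * rG) * Real.exp (-((1 - α) * δ * (geo9K i).dist b y'))) := by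
    intro b
    have h1 : ((geo9K i).len b ^ 2)⁻¹ * (geo9K i).len b ^ 2 = 1 := inv_mul_cancel₀ (pow_pos (hGeo.lenpos b) 2).ne'
    calc rC * P a * ((geo9K i).len b ^ 2)⁻¹ * Real.exp (-(δ * (geo9K i).dist a b)) *
          (Real.exp ((δ + α₁ * δ₁) * ((ℓ : ℝ) + 4)) * L₀ ^ 2 * B6.c1 dd δ α * (geo9K i).len b ^ 2 * rG *
            Real.exp (-((1 - α) * δ * (geo9K i).dist b y')))
        = rC * P a * Real.exp (-(δ * (geo9K i).dist a b)) *
          ((Real.exp ((δ + α₁ * δ₁) * ((ℓ : ℝ) + 4)) * L₀ ^ 2 * B6.c1 dd δ α * rG) * Real.exp (-((1 - α) * δ * (geo9K i).dist b y'))) *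
          (((geo9K i).len b ^ 2)⁻¹ * (geo9K i).len b ^ 2) := by ring
      _ = _ := by rw [h1, mul_one]
  have hr : 0 ≤ Real.exp ((δ + α₁ * δ₁) * ((ℓ : ℝ) + 4)) * L₀ ^ 2 * B6.c1 dd δ α * rG := mul_nonneg (mul_nonneg hA₀ hc1) hrG
  have hconv := kernel_G0_conv_le (g := toB6 (geo9K i) R₀ H₀) dd δ α rC (Real.exp ((δ + α₁ * δ₁) * ((ℓ : ℝ) + 4)) * L₀ ^ 2 * B6.c1 dd δ α * rG)
    P hrC hP hr hαδ htri h261 a y'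
  calc ∑ b : (geo9K i).Site, rC * P a * ((geo9K i).len b ^ 2)⁻¹ * Real.exp (-(δ * (geo9K i).dist a b)) *
          (Real.exp ((δ + α₁ * δ₁) * ((ℓ : ℝ) + 4)) * L₀ ^ 2 * B6.c1 dd δ α * (geo9K i).len b ^ 2 * rG *
            Real.exp (-((1 - α) * δ * (geo9K i).dist b y')))
      = ∑ b : (geo9K i).Site, rC * P a * Real.exp (-(δ * (geo9K i).dist a b)) *
          ((Real.exp ((δ + α₁ * δ₁) * ((ℓ : ℝ) + 4)) * L₀ ^ 2 * B6.c1 dd δ α * rG) * Real.exp (-((1 - α) * δ * (geo9K i).dist b y'))) :=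
        Finset.sum_congr rfl fun b _ => hcancel b
    _ ≤ rC * B6.c1 dd δ α * P a * (Real.exp ((δ + α₁ * δ₁) * ((ℓ : ℝ) + 4)) * L₀ ^ 2 * B6.c1 dd δ α * rG) *
          Real.exp (-((1 - α) * δ * (geo9K i).dist a y')) := hconv

end Majorant

/-! ## §1b The block count in the two currencies: `((Lʲη)_c∕η)^{d+1} = (L^{d+1})^{j(c)}` (the doors' weight vs node N06's `n⁻¹`-weighted class `Z_{n⁻¹}`) -/

section Units

variable {θ : Stage3Params} {Mstar : ℕ}

/-- ★ the block count of the doors, `((Lʲη)_c∕η)^{d+1}`, IS node N06's `n_c = (L^{d+1})^{j(c)}` (the inverse of the weight of the class `Z_{n⁻¹}` in n06-w5's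
`c12_pins` ∕ `hasMajorantHom_raw_of_hasMaj_cNorm_weightNorm`): `(Lʲη)_c = L^{j(c)}·η` (`lenB_eq`, `beta_level`). For instantiating `hC1raw` from the raw class reading.
[cite: Balaban1985BackgroundPropagators, (3.132) p.422 («(L^{j′}η)^{−d}»), (3.41) p.397, p.389 (T_η); Balaban1984PropagatorsII, (2.1) p.224, bookkeeping] -/
theorem blockCount_eq_pow_lvl (x : MemberY θ.d₆ θ.ℓ₆ θ.hd' θ.hL' θ.b₀ θ.b₁ Mstar) (c : (geo9Y x).Site) :
    ((geo9Y x).len c / etaBY x.toKIdx) ^ (θ.d₆ + 1) = ((((θ.ℓ₆ + 1 : ℕ) : ℝ)) ^ (θ.d₆ + 1)) ^ lvl x.hN x.D x.hk c := by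
  have hη0 := etaBY_pos' x
  have hη : etaBY x.toKIdx = etaS x.toKIdx := by rw [etaS_eq_abs_cf_inv]; rfl
  have hlen : (geo9Y x).len c = (((θ.ℓ₆ + 1 : ℕ) : ℝ)) ^ lvl x.hN x.D x.hk c * etaBY x.toKIdx := by
    rw [geo9Y_len_eq_lenB, lenB_eq, beta_level x.hN x.D x.hk (le_trans one_le_two x.hk2), hη]
    push_cast
    ring
  rw [hlen, mul_div_assoc, div_self hη0.ne', mul_one, ← pow_mul, mul_comm, pow_mul]

end Units

/-! ## §2 At the pins: the doors' transpose schema `hH1T` from `G₁` in the `e0` shape and `C₁` raw — weight `P` exactly -/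

section AtPins

variable {θ : Stage3Params} {Mstar : ℕ} [NeZero N]
variable [∀ x : MemberY θ.d₆ θ.ℓ₆ θ.hd' θ.hL' θ.b₀ θ.b₁ Mstar, Fintype (geo9Y x).Site]

/-- ★★ **THE DOORS' TRANSPOSE SCHEMA `hH1T` AT `𝔗 := (C₁ ∘ Q) ∘ G₁` FROM `G₁` IN THE `e0` SHAPE AND `C₁` RAW — WEIGHT `W_T = P` EXACTLY** (p712155 §2
`hH1T_of_G1_C1_lettersR`'s twin over §1): class-parametric carrier `bg9YR (M_N(ℂ)) SU(N) R₁ R₂` (`MemOfFam SU(N) R₁`, `c` free), residual family `𝔯`, above ONE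
threshold and in the regime: (i) the transpose identity (p712155 §1, from `hΔ2`) and (ii) the [4]-(2.51) majorant
`r_C·c₁·P(c)·(e^{(δ₀+α_F(1−2α)δ₀)(ℓ+4)}·(ℓ+1)²·c₁·r_G)·e^{−(1−α)δ₀ d(c,y′)}` of `𝔗 x U` from the fine carrier to the coarse one, from `hG1e0` ((3.42) for `G₁` with
its `(Lʲη)_a²`, DISPLAYED) and `hC1raw` ((3.132) for `(QG₁Q\*)⁻¹` read raw with output weight `P = W_C x`, DISPLAYED); member facts (2.61) at `(δ₀, α)` and [4]
(2.60) at `((1−2α)δ₀, α_F)`, `L₀ = ℓ+1` (`lemma21Pack_geo9Y`).  At `W_C x c = n_c` the doors' weight law holds at every `c` (§3).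
[cite: Balaban1985BackgroundPropagators, (3.129) p.421, (3.42) p.397, p.398 (remark after (3.47)), (3.132)–(3.133) p.422, Thm 3.12 p.423, (3.12)–(3.14) p.393, Thm 3.11 p.416; Balaban1984PropagatorsII, (2.51)–(2.56) pp.232–233, Lemma 2.1 (2.60)–(2.61) p.234] -/
theorem hH1T_of_G1e0_C1raw_lettersR (q : PinPrims) (hq : q.OK) (H : MemberY θ.d₆ θ.ℓ₆ θ.hd' θ.hL' θ.b₀ θ.b₁ Mstar → Prop)
    (R₁ R₂ : RegFamY θ.d₆ θ.ℓ₆ θ.hd' θ.hL' θ.b₀ θ.b₁ Mstar (Matrix (Fin N) (Fin N) ℂ)) (hG : MemOfFam (specialUnitaryUnits (Fin N)) R₁) (c : ℝ)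
    (𝔯 : ResY N θ Mstar)
    (hΔ2 : ∀ (x : MemberY θ.d₆ θ.ℓ₆ θ.hd' θ.hL' θ.b₀ θ.b₁ Mstar) (U : (bg9Y (Matrix (Fin N) (Fin N) ℂ) (specialUnitaryUnits (Fin N)) x).Cfg),
      (∀ μ z, U μ z ∈ specialUnitaryUnits (Fin N)) → IsSymmTr (fun _ => (1 : ℝ)) ((𝔯 x).Δ2 U))
    (bI : ∀ x : MemberY θ.d₆ θ.ℓ₆ θ.hd' θ.hL' θ.b₀ θ.b₁ Mstar, FBondY x.toKIdx → IBondY x.toKIdx)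
    (hβ1 : ∀ (x : MemberY θ.d₆ θ.ℓ₆ θ.hd' θ.hL' θ.b₀ θ.b₁ Mstar) (f : FBondY x.toKIdx), (geomT x.D).dist (β x.hN x.D x.hk (bI x f)) (blkV1 x.hN x.D f) ≤ 1)
    (WC : ∀ x : MemberY θ.d₆ θ.ℓ₆ θ.hd' θ.hL' θ.b₀ θ.b₁ Mstar, IBondY x.toKIdx → ℝ) (hWC : ∀ x c, 0 ≤ WC x c)
    (rG rC M a : ℝ) (hrG : 0 ≤ rG) (hrC : 0 ≤ rC)
    (hG1e0 : ∀ x : MemberY θ.d₆ θ.ℓ₆ θ.hd' θ.hL' θ.b₀ θ.b₁ Mstar, M ≤ (geo9Y x).M → ∀ α₀ : ℝ, 0 < α₀ → (geo9Y x).M * α₀ ≤ a →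
      ∀ U : (bg9Y (Matrix (Fin N) (Fin N) ℂ) (specialUnitaryUnits (Fin N)) x).Cfg,
        (bg9YR (Matrix (Fin N) (Fin N) ℂ) (specialUnitaryUnits (Fin N)) R₁ R₂ x).Reg335 c α₀ U →
        (bg9YR (Matrix (Fin N) (Fin N) ℂ) (specialUnitaryUnits (Fin N)) R₁ R₂ x).Reg336 c α₀ U →
          HasMajorant (g := toB6 (geo9Y x) 1 (H x)) (blkBK x.toKIdx (bI x))
            (GcoK x.toKIdx (trBasis N) (bg9Y (Matrix (Fin N) (Fin N) ℂ) (specialUnitaryUnits (Fin N)) x) (fun U => U)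
              (G1Y x.toKIdx (parSymY x.toKIdx) (parBY x.toKIdx) (GpPhysY x.toKIdx (parSymY x.toKIdx)) (𝔯 x).Δ2) U)
            (fun a b => rG * (geo9Y x).len a ^ 2 * Real.exp (-((1 - q.α) * q.δ₀ * (geo9Y x).dist a b))))
    (hC1raw : ∀ x : MemberY θ.d₆ θ.ℓ₆ θ.hd' θ.hL' θ.b₀ θ.b₁ Mstar, M ≤ (geo9Y x).M → ∀ α₀ : ℝ, 0 < α₀ → (geo9Y x).M * α₀ ≤ a →
      ∀ U : (bg9Y (Matrix (Fin N) (Fin N) ℂ) (specialUnitaryUnits (Fin N)) x).Cfg,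
        (bg9YR (Matrix (Fin N) (Fin N) ℂ) (specialUnitaryUnits (Fin N)) R₁ R₂ x).Reg335 c α₀ U →
        (bg9YR (Matrix (Fin N) (Fin N) ℂ) (specialUnitaryUnits (Fin N)) R₁ R₂ x).Reg336 c α₀ U →
          HasMajorantHom (g := toB6 (geo9Y x) 1 (H x)) (blkHK x.toKIdx) (blkHK x.toKIdx)
            (C1coK x.toKIdx (trBasis N) (bg9Y (Matrix (Fin N) (Fin N) ℂ) (specialUnitaryUnits (Fin N)) x) (fun U => U)
              (parSymY x.toKIdx) (parBY x.toKIdx) (GpPhysY x.toKIdx (parSymY x.toKIdx)) (𝔯 x).Δ2 U)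
            (fun a b => rC * WC x a * ((geo9Y x).len b ^ 2)⁻¹ * Real.exp (-(q.δ₀ * (geo9Y x).dist a b)))) :
    ∃ MT : ℝ, ∀ x : MemberY θ.d₆ θ.ℓ₆ θ.hd' θ.hL' θ.b₀ θ.b₁ Mstar, MT ≤ (geo9Y x).M → M ≤ (geo9Y x).M → ∀ α₀ : ℝ, 0 < α₀ → (geo9Y x).M * α₀ ≤ a →
      ∀ U : (bg9Y (Matrix (Fin N) (Fin N) ℂ) (specialUnitaryUnits (Fin N)) x).Cfg,
        (bg9YR (Matrix (Fin N) (Fin N) ℂ) (specialUnitaryUnits (Fin N)) R₁ R₂ x).Reg335 c α₀ U →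
        (bg9YR (Matrix (Fin N) (Fin N) ℂ) (specialUnitaryUnits (Fin N)) R₁ R₂ x).Reg336 c α₀ U →
          IsTransposePair (HcoK x.toKIdx (trBasis N) (bg9Y (Matrix (Fin N) (Fin N) ℂ) (specialUnitaryUnits (Fin N)) x) (fun U => U)
              (H1Y x.toKIdx (parSymY x.toKIdx) (parBY x.toKIdx) (GpPhysY x.toKIdx (parSymY x.toKIdx)) (𝔯 x).Δ2) U)
            ((C1coK x.toKIdx (trBasis N) (bg9Y (Matrix (Fin N) (Fin N) ℂ) (specialUnitaryUnits (Fin N)) x) (fun U => U)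
                (parSymY x.toKIdx) (parBY x.toKIdx) (GpPhysY x.toKIdx (parSymY x.toKIdx)) (𝔯 x).Δ2 U ∘ₗ
              QcoKH x.toKIdx (trBasis N) (bg9Y (Matrix (Fin N) (Fin N) ℂ) (specialUnitaryUnits (Fin N)) x) (fun U => U) (parBY x.toKIdx) U) ∘ₗ
              GcoK x.toKIdx (trBasis N) (bg9Y (Matrix (Fin N) (Fin N) ℂ) (specialUnitaryUnits (Fin N)) x) (fun U => U)
                (G1Y x.toKIdx (parSymY x.toKIdx) (parBY x.toKIdx) (GpPhysY x.toKIdx (parSymY x.toKIdx)) (𝔯 x).Δ2) U) ∧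
            HasMajorantHom (g := toB6 (geo9Y x) 1 (H x)) (fun p : XBK (TrIdx N) x.toKIdx => bI x p.1) (fun p : XHK (TrIdx N) x.toKIdx => p.1)
              ((C1coK x.toKIdx (trBasis N) (bg9Y (Matrix (Fin N) (Fin N) ℂ) (specialUnitaryUnits (Fin N)) x) (fun U => U)
                  (parSymY x.toKIdx) (parBY x.toKIdx) (GpPhysY x.toKIdx (parSymY x.toKIdx)) (𝔯 x).Δ2 U ∘ₗ
                QcoKH x.toKIdx (trBasis N) (bg9Y (Matrix (Fin N) (Fin N) ℂ) (specialUnitaryUnits (Fin N)) x) (fun U => U) (parBY x.toKIdx) U) ∘ₗ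
                GcoK x.toKIdx (trBasis N) (bg9Y (Matrix (Fin N) (Fin N) ℂ) (specialUnitaryUnits (Fin N)) x) (fun U => U)
                  (G1Y x.toKIdx (parSymY x.toKIdx) (parBY x.toKIdx) (GpPhysY x.toKIdx (parSymY x.toKIdx)) (𝔯 x).Δ2) U)
              (fun c y' => (rC * B6.c1 (exp261 (@geo9Y θ.d₆ θ.ℓ₆ θ.hd' θ.hL' θ.b₀ θ.b₁ Mstar) q.δ₀ q.α) q.δ₀ q.α *
                  (Real.exp ((q.δ₀ + q.αF * ((1 - 2 * q.α) * q.δ₀)) * ((θ.ℓ₆ : ℝ) + 4)) * (((θ.ℓ₆ + 1 : ℕ) : ℝ)) ^ 2 *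
                    B6.c1 (exp261 (@geo9Y θ.d₆ θ.ℓ₆ θ.hd' θ.hL' θ.b₀ θ.b₁ Mstar) q.δ₀ q.α) q.δ₀ q.α * rG)) *
                WC x c * Real.exp (-((1 - q.α) * q.δ₀ * (geo9Y x).dist c y'))) := by
  obtain ⟨Mth, h261, hfacts, -⟩ :=
    lemma21Pack_geo9Y (d := θ.d₆) (ℓ := θ.ℓ₆) (hd := θ.hd') (hL := θ.hL') (b₀ := θ.b₀) (b₁ := θ.b₁) (Mstar := Mstar) H hq.α_pos hq.α_lt
      hq.δ₀_pos hq.αF_pos (by linarith only [hq.αF_lt])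
  have hN : 0 < N := Nat.pos_of_ne_zero (NeZero.ne N)
  refine ⟨Mth, fun x hMx hMM α₀ hα ha U hU hU' => ?_⟩
  have hGv : ∀ μ z, U μ z ∈ specialUnitaryUnits (Fin N) := hG x c α₀ U hU
  refine ⟨isTransposePair_HcoK_H1Y_physY x.toKIdx (bg9Y (Matrix (Fin N) (Fin N) ℂ) (specialUnitaryUnits (Fin N)) x) (fun U => U) (𝔯 x).Δ2
    specialUnitaryUnits_le_unitaryUnits hN U hGv (hΔ2 x U hGv), ?_⟩
  letI : Fintype (geo9K x.toKIdx).Site := (inferInstance : Fintype (geo9Y x).Site)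
  have hGeo : GeoOK (geo9K x.toKIdx) := ⟨geo9Y_dist_triangle x, geo9Y_dist_comm x, geo9K_dist_nonneg x.toKIdx, geo9Y_len_pos x⟩
  have hαδ : 0 ≤ (1 - q.α) * q.δ₀ := mul_nonneg (by linarith only [hq.α_lt]) hq.δ₀_pos.le
  have hαδ₁ : 0 ≤ q.αF * ((1 - 2 * q.α) * q.δ₀) := mul_nonneg hq.αF_pos.le (mul_nonneg (by linarith only [hq.α_lt]) hq.δ₀_pos.le)
  have h := hasMajorantHom_CQG_of_e0_raw_letters (R₀ := 1) (H₀ := H x) x.toKIdx (bg9Y (Matrix (Fin N) (Fin N) ℂ) (specialUnitaryUnits (Fin N)) x) (fun U => U)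
    (hβ1 x) U (fun s s' => specialUnitaryUnits_le_U1 (Node00.parBY_mem x.toKIdx (G := specialUnitaryUnits (Fin N)) hGv s s')) hGeo (hfacts x hMx)
    hq.δ₀_pos.le hαδ hαδ₁ hrG hrC (hWC x) (h261 x hMx) (hG1e0 x hMM α₀ hα ha U hU hU') (hC1raw x hMM α₀ hα ha U hU hU')
  refine B6RandomWalkHom.hasMajorantHom_mono _ _ h fun a b => le_of_eq ?_
  have hd : (geo9Y x).dist a b = (geo9K x.toKIdx).dist a b := rfl
  rw [hd]
  ring

/-! ## §3 The doors' 𝒥-row input (b†) from `hG1sup + hC1sup + hΔ2 + hreg` — the transpose schema ELIMINATED -/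

/-! ## §3 The doors' 𝒥-row input (b†) at EVERY coarse bond, at the block count — no weight law -/

/-- ★★★ **THE (3.24) DOORS' 𝒥-ROW INPUT (b†) AT EVERY COARSE BOND FROM `G₁` IN THE `e0` SHAPE AND `C₁` RAW AT THE BLOCK COUNT — NO WEIGHT LAW** (p712155 §3's
twin: §2 at `W_C x c := n_c = ((Lʲη)_c∕η)^{d+1}` ∘ `B9Eq3136HstarJAtPinsLetterFamily.…_blockCount`, `3 ≤ d+1`): above ONE threshold and in the regime, for EVERY
coarse bond `c`, `η^{d+1}·‖(H₁(U)†J(U))(c)‖ ≤ t_{HJ}·a` from `hG1e0` + `hC1raw` (at `P = n`) + `hΔ2` + r06's regularity datum `hreg` + the pins + the budget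
`α_F(1−2α)δ₀ + ρ_R ≤ (1−α)δ₀` + ONE constant `t_{HJ}` at the explicit `B_T := r_C·c₁·(e^{(δ₀+α_F(1−2α)δ₀)(ℓ+4)}·(ℓ+1)²·c₁·r_G)`.  This is the (b†) face that is
NON-VACUOUS at d+1 = 4 along the class-letter road (LOCATED dag-n08-d g44): `hC1raw` at `P = n` is n06-w5 §2's raw reading of the `𝔠⁽²⁾ → Z_{n⁻¹}` letter verbatim,
`hG1e0` is (3.42)'s shape for `G₁`.
[cite: Balaban1985BackgroundPropagators, p.422 (the sentence between (3.136) and (3.137)), (3.129) p.421, (3.42) p.397, (3.132)–(3.133) p.422, Thm 3.12 p.423, (3.36) p.396, (3.13) p.392, (3.156) p.428; Balaban1984PropagatorsII, (2.51)–(2.56) pp.232–233, Lemma 2.1 (2.60)–(2.61) pp.233–234] -/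
theorem etaDY_mul_norm_trAdjY_H1Y_JY_le_of_G1e0_C1raw_lettersR_blockCount (hD : 3 ≤ θ.d₆ + 1) (q : PinPrims) (hq : q.OK) (H : MemberY θ.d₆ θ.ℓ₆ θ.hd' θ.hL' θ.b₀ θ.b₁ Mstar → Prop)
    (R₁ R₂ : RegFamY θ.d₆ θ.ℓ₆ θ.hd' θ.hL' θ.b₀ θ.b₁ Mstar (Matrix (Fin N) (Fin N) ℂ)) (hG : MemOfFam (specialUnitaryUnits (Fin N)) R₁) (c : ℝ)
    (𝔯 : ResY N θ Mstar)
    (hΔ2 : ∀ (x : MemberY θ.d₆ θ.ℓ₆ θ.hd' θ.hL' θ.b₀ θ.b₁ Mstar) (U : (bg9Y (Matrix (Fin N) (Fin N) ℂ) (specialUnitaryUnits (Fin N)) x).Cfg),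
      (∀ μ z, U μ z ∈ specialUnitaryUnits (Fin N)) → IsSymmTr (fun _ => (1 : ℝ)) ((𝔯 x).Δ2 U))
    (bI : ∀ x : MemberY θ.d₆ θ.ℓ₆ θ.hd' θ.hL' θ.b₀ θ.b₁ Mstar, FBondY x.toKIdx → IBondY x.toKIdx)
    (hbI0 : ∀ (x : MemberY θ.d₆ θ.ℓ₆ θ.hd' θ.hL' θ.b₀ θ.b₁ Mstar) (f : FBondY x.toKIdx), bI x f = bI x ⟨f.src, 0⟩)
    (hβ1 : ∀ (x : MemberY θ.d₆ θ.ℓ₆ θ.hd' θ.hL' θ.b₀ θ.b₁ Mstar) (f : FBondY x.toKIdx), (geomT x.D).dist (β x.hN x.D x.hk (bI x f)) (blkV1 x.hN x.D f) ≤ 1)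
    (rG rC cJ ρR tHJ M a : ℝ) (hrG : 0 ≤ rG) (hrC : 0 ≤ rC) (hcJ : 0 ≤ cJ) (hρR : 0 < ρR) (hM : 0 < M) (ha1 : cJ * a ≤ 1)
    (hρ : q.αF * ((1 - 2 * q.α) * q.δ₀) + ρR ≤ (1 - q.α) * q.δ₀)
    (htHJ : N * basisBound39 (trBasis N) ^ 2 * (10 ^ 4 * ((θ.d₆ : ℝ) + 1) * cJ) *
      (((θ.d₆ : ℝ) + 1) * Fintype.card (TrIdx N) *
        (rC * B6.c1 (exp261 (@geo9Y θ.d₆ θ.ℓ₆ θ.hd' θ.hL' θ.b₀ θ.b₁ Mstar) q.δ₀ q.α) q.δ₀ q.α *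
          (Real.exp ((q.δ₀ + q.αF * ((1 - 2 * q.α) * q.δ₀)) * ((θ.ℓ₆ : ℝ) + 4)) * (((θ.ℓ₆ + 1 : ℕ) : ℝ)) ^ 2 *
            B6.c1 (exp261 (@geo9Y θ.d₆ θ.ℓ₆ θ.hd' θ.hL' θ.b₀ θ.b₁ Mstar) q.δ₀ q.α) q.δ₀ q.α * rG))) *
      ((((θ.ℓ₆ + 1 : ℕ) : ℝ) ^ 3) * rowConst261 (geo9Y (d := θ.d₆) (ℓ := θ.ℓ₆) (hd := θ.hd') (hL := θ.hL') (b₀ := θ.b₀) (b₁ := θ.b₁) (Mstar := Mstar)) ρR) ≤ tHJ)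
    (hG1e0 : ∀ x : MemberY θ.d₆ θ.ℓ₆ θ.hd' θ.hL' θ.b₀ θ.b₁ Mstar, M ≤ (geo9Y x).M → ∀ α₀ : ℝ, 0 < α₀ → (geo9Y x).M * α₀ ≤ a →
      ∀ U : (bg9Y (Matrix (Fin N) (Fin N) ℂ) (specialUnitaryUnits (Fin N)) x).Cfg,
        (bg9YR (Matrix (Fin N) (Fin N) ℂ) (specialUnitaryUnits (Fin N)) R₁ R₂ x).Reg335 c α₀ U →
        (bg9YR (Matrix (Fin N) (Fin N) ℂ) (specialUnitaryUnits (Fin N)) R₁ R₂ x).Reg336 c α₀ U →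
          HasMajorant (g := toB6 (geo9Y x) 1 (H x)) (blkBK x.toKIdx (bI x))
            (GcoK x.toKIdx (trBasis N) (bg9Y (Matrix (Fin N) (Fin N) ℂ) (specialUnitaryUnits (Fin N)) x) (fun U => U)
              (G1Y x.toKIdx (parSymY x.toKIdx) (parBY x.toKIdx) (GpPhysY x.toKIdx (parSymY x.toKIdx)) (𝔯 x).Δ2) U)
            (fun a b => rG * (geo9Y x).len a ^ 2 * Real.exp (-((1 - q.α) * q.δ₀ * (geo9Y x).dist a b))))
    (hC1raw : ∀ x : MemberY θ.d₆ θ.ℓ₆ θ.hd' θ.hL' θ.b₀ θ.b₁ Mstar, M ≤ (geo9Y x).M → ∀ α₀ : ℝ, 0 < α₀ → (geo9Y x).M * α₀ ≤ a →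
      ∀ U : (bg9Y (Matrix (Fin N) (Fin N) ℂ) (specialUnitaryUnits (Fin N)) x).Cfg,
        (bg9YR (Matrix (Fin N) (Fin N) ℂ) (specialUnitaryUnits (Fin N)) R₁ R₂ x).Reg335 c α₀ U →
        (bg9YR (Matrix (Fin N) (Fin N) ℂ) (specialUnitaryUnits (Fin N)) R₁ R₂ x).Reg336 c α₀ U →
          HasMajorantHom (g := toB6 (geo9Y x) 1 (H x)) (blkHK x.toKIdx) (blkHK x.toKIdx)
            (C1coK x.toKIdx (trBasis N) (bg9Y (Matrix (Fin N) (Fin N) ℂ) (specialUnitaryUnits (Fin N)) x) (fun U => U)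
              (parSymY x.toKIdx) (parBY x.toKIdx) (GpPhysY x.toKIdx (parSymY x.toKIdx)) (𝔯 x).Δ2 U)
            (fun a b => rC * ((geo9Y x).len a / etaBY x.toKIdx) ^ (θ.d₆ + 1) * ((geo9Y x).len b ^ 2)⁻¹ * Real.exp (-(q.δ₀ * (geo9Y x).dist a b))))
    (hreg : ∀ x : MemberY θ.d₆ θ.ℓ₆ θ.hd' θ.hL' θ.b₀ θ.b₁ Mstar, M ≤ (geo9Y x).M → ∀ α₀ : ℝ, 0 < α₀ → (geo9Y x).M * α₀ ≤ a →
      ∀ U : (bg9Y (Matrix (Fin N) (Fin N) ℂ) (specialUnitaryUnits (Fin N)) x).Cfg,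
        (bg9YR (Matrix (Fin N) (Fin N) ℂ) (specialUnitaryUnits (Fin N)) R₁ R₂ x).Reg335 c α₀ U →
        (bg9YR (Matrix (Fin N) (Fin N) ℂ) (specialUnitaryUnits (Fin N)) R₁ R₂ x).Reg336 c α₀ U →
          ∀ μ s, RegularAt (shiftsV1 (PV θ.d₆ θ.ℓ₆ x.toKIdx.m x.toKIdx.K θ.hd' θ.hL')) U (etaBY x.toKIdx)
            (cJ * ((geo9Y x).M * α₀)) ((geo9Y x).len (bI x ⟨s, 0⟩)) μ s) :
    ∃ MH : ℝ, ∀ x : MemberY θ.d₆ θ.ℓ₆ θ.hd' θ.hL' θ.b₀ θ.b₁ Mstar, MH ≤ (geo9Y x).M → M ≤ (geo9Y x).M → ∀ α₀ : ℝ, 0 < α₀ → (geo9Y x).M * α₀ ≤ a →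
      ∀ U : (bg9Y (Matrix (Fin N) (Fin N) ℂ) (specialUnitaryUnits (Fin N)) x).Cfg,
        (bg9YR (Matrix (Fin N) (Fin N) ℂ) (specialUnitaryUnits (Fin N)) R₁ R₂ x).Reg335 c α₀ U →
        (bg9YR (Matrix (Fin N) (Fin N) ℂ) (specialUnitaryUnits (Fin N)) R₁ R₂ x).Reg336 c α₀ U →
          ∀ c : IBondY x.toKIdx,
            etaDY x * ‖trAdjY (trDualMatY N) (H1Y x.toKIdx (parSymY x.toKIdx) (parBY x.toKIdx) (GpPhysY x.toKIdx (parSymY x.toKIdx)) (𝔯 x).Δ2 U)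
              (JY x.toKIdx U) c‖ ≤ tHJ * a  := by
  obtain ⟨MT, hT⟩ := hH1T_of_G1e0_C1raw_lettersR q hq H R₁ R₂ hG c 𝔯 hΔ2 bI hβ1
    (fun x c => ((geo9Y x).len c / etaBY x.toKIdx) ^ (θ.d₆ + 1))
    (fun x c => pow_nonneg (div_nonneg (geo9Y_len_pos x c).le (etaBY_pos' x).le) _) rG rC M a hrG hrC hG1e0 hC1raw
  have hBT : 0 ≤ rC * B6.c1 (exp261 (@geo9Y θ.d₆ θ.ℓ₆ θ.hd' θ.hL' θ.b₀ θ.b₁ Mstar) q.δ₀ q.α) q.δ₀ q.α *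
      (Real.exp ((q.δ₀ + q.αF * ((1 - 2 * q.α) * q.δ₀)) * ((θ.ℓ₆ : ℝ) + 4)) * (((θ.ℓ₆ + 1 : ℕ) : ℝ)) ^ 2 *
        B6.c1 (exp261 (@geo9Y θ.d₆ θ.ℓ₆ θ.hd' θ.hL' θ.b₀ θ.b₁ Mstar) q.δ₀ q.α) q.δ₀ q.α * rG) := by
    have h := B6RandomWalk.c1_nonneg (exp261 (@geo9Y θ.d₆ θ.ℓ₆ θ.hd' θ.hL' θ.b₀ θ.b₁ Mstar) q.δ₀ q.α) q.δ₀ q.α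
    positivity
  have hMmax : 0 < max M MT := lt_max_of_lt_left hM
  obtain ⟨MH, hMH⟩ := etaDY_mul_norm_trAdjY_H1Y_JY_le_of_transpose_schemas_blockCount (N := N) hD q hq H R₁ R₂ c 𝔯 bI hbI0
    (fun x U => (C1coK x.toKIdx (trBasis N) (bg9Y (Matrix (Fin N) (Fin N) ℂ) (specialUnitaryUnits (Fin N)) x) (fun U => U)
        (parSymY x.toKIdx) (parBY x.toKIdx) (GpPhysY x.toKIdx (parSymY x.toKIdx)) (𝔯 x).Δ2 U ∘ₗ
      QcoKH x.toKIdx (trBasis N) (bg9Y (Matrix (Fin N) (Fin N) ℂ) (specialUnitaryUnits (Fin N)) x) (fun U => U) (parBY x.toKIdx) U) ∘ₗ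
      GcoK x.toKIdx (trBasis N) (bg9Y (Matrix (Fin N) (Fin N) ℂ) (specialUnitaryUnits (Fin N)) x) (fun U => U)
        (G1Y x.toKIdx (parSymY x.toKIdx) (parBY x.toKIdx) (GpPhysY x.toKIdx (parSymY x.toKIdx)) (𝔯 x).Δ2) U)
    cJ _ ((1 - q.α) * q.δ₀) ρR tHJ (max M MT) a hcJ hBT hρR hMmax ha1 hρ htHJ
    (fun x hMx α₀ hα ha U hU hU' => by
      have h := hT x ((le_max_right _ _).trans hMx) ((le_max_left _ _).trans hMx) α₀ hα ha U hU hU'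
      refine ⟨h.1, B6RandomWalkHom.hasMajorantHom_mono _ _ h.2 fun c' y' => le_of_eq ?_⟩
      ring)
    (fun x hMx α₀ hα ha U hU hU' => hreg x ((le_max_left _ _).trans hMx) α₀ hα ha U hU hU')
  exact ⟨max MH MT, fun x hMx hMM α₀ hα ha U hU hU' c =>
    (hMH x ((le_max_left _ _).trans hMx) (max_le hMM ((le_max_right _ _).trans hMx)) α₀ hα ha U hU hU' c).trans_eq (mul_one _)⟩

end AtPins

end Literature.MathematicalPhysics.QuantumFieldTheory.Balaban1983to89.B9Eq3129H1TransposeCancel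

end
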